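import Mathlib
import Summits.NavierStokesRegularity.NavierStokesRegularity.Theorems.ThreadingFluxHorizonTowerProfileStructure
import Summits.NavierStokesRegularity.NavierStokesRegularity.Theorems.ThreadingFluxHorizonTowerZonalForm
import HarnessLib

/-!
# Crux `PoloidalLiouville` (stmt-NavierStokesRegularity-1222, wall W1), crux idea «horizon-threading-tower» (ns-idea-15):
# RUNG R1 of the identification chain — the curl of the horizon profile is TOROIDAL: `Ω = curl U_H = (l−1)(l+2) r^{−(l+1)} ∇H × x`

Support file (Theorems-side tooling, `--supports stmt-NavierStokesRegularity-1222 --as helper`; seat ns-wall-eng-7 g3, cell ns-wall-extremal).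
First rung of the STRUCTURED identification chain of the engine identity E-𝔏₂ (`pub/ns-wall-extremal/ARM-B/w7g3/L2-IDENTITY.md`, DATUM B-ht2:
`𝔏₂[U_H] = −4(l−1)(l+2) r^{−3(l−1)} det(∇H, ∇|∇H|², x)`, exact on the generic harmonic for `l ≤ 7`): for a smooth degree-`l` homogeneous HARMONIC
`H` and `x ≠ 0`,

* `HorizonTower.curl_horizonProfile` — `curl (horizonProfile l H 0) x = ((l−1)(l+2) · (‖x‖²)^{−(l+1)/2}) • (∇H(x) × x)`.

Proof: ARM A's normal form `U = 2∇φ − (div ∇φ) y` (`φ = ‖z‖^{1−l}H`, `horizonProfile_eq_normalForm`) holds near `x`; `curl ∇φ = 0`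
(`curl_gradient_eq_zero_of_contDiffAt`), `curl(ψ y) = ∇ψ × y` (`curl_smul_self`); `ψ = div ∇φ = (1−l)(l+2)(‖y‖²)^{−(l+1)/2} H` near `x`
(`divergence_gradient_mul_rpow_normSq` — the one place harmonicity enters), `∇ψ` by `gradient_mul_rpow_normSq`, and `x × x = 0`.
Pure vector calculus; information-grade for W1/W2; `PoloidalLiouville` (1222) / NS regularity OPEN and untouched. [folklore]
-/

-- the summit and its single problem share the name (D-0017 nested layout)
set_option linter.dupNamespace false

noncomputable section

open Set Function Filter Topology
open scoped Topology RealInnerProductSpace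
open Literature.Analysis.FluidPDE

namespace Summit.NavierStokesRegularity.NavierStokesRegularity.Theorems.PoloidalLiouville.HorizonTower

open PoloidalField

/-- `(c • u + d • x) × x = c • (u × x)` — linearity of the tree's cross product in the first slot and `x × x = 0`, coordinatewise.
[cite: MajdaBertozziCUP2002, §1.1 (vector identities)] -/
theorem cross_smul_add_smul_self (c d : ℝ) (u x : E3) : cross (c • u + d • x) x = c • cross u x := by
  obtain ⟨c0, c1, c2⟩ := cross_fin3 (c • u + d • x) x
  obtain ⟨d0, d1, d2⟩ := cross_fin3 u x
  ext i
  fin_cases i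
  · simp only [Fin.zero_eta, Fin.isValue, c0, PiLp.add_apply, PiLp.smul_apply, smul_eq_mul, d0]; ring
  · simp only [Fin.mk_one, Fin.isValue, c1, PiLp.add_apply, PiLp.smul_apply, smul_eq_mul, d1]; ring
  · simp only [Fin.reduceFinMk, Fin.isValue, c2, PiLp.add_apply, PiLp.smul_apply, smul_eq_mul, d2]; ring

section Curl

variable {l : ℕ} {H : E3 → ℝ}

/-- ★ **R1: the curl of the horizon profile is toroidal.**  For `H` smooth, homogeneous of degree `l ≥ 1` and harmonic, off the origin
`curl U_H (x) = ((l−1)(l+2) · (‖x‖²)^{−(l+1)/2}) • (∇H(x) × x)`. [folklore] -/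
theorem curl_horizonProfile (hl : 1 ≤ l) (hH : ContDiff ℝ (⊤ : ℕ∞) H)
    (hhom : ∀ (c : ℝ) (y : E3), H (c • y) = c ^ l * H y) (hharm : ∀ y, Laplacian.laplacian H y = 0) {x : E3} (hx : x ≠ 0) :
    curl (horizonProfile l H 0) x
      = (((l : ℝ) - 1) * ((l : ℝ) + 2) * (‖x‖ ^ 2) ^ (-((l : ℝ) + 1) / 2)) • cross (gradient H x) x := by
  have hHd : ∀ z, DifferentiableAt ℝ H z := fun z => (hH.differentiable (by simp)).differentiableAt
  have hopen : ∀ᶠ y in 𝓝 x, y ≠ (0 : E3) := isOpen_compl_singleton.mem_nhds hx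
  -- (1) near `x`, `U` is the normal form `2∇φ − ψ y`
  set φ : E3 → ℝ := fun z => ‖z‖ ^ ((1 : ℤ) - l) * H z with hφ
  set ψ : E3 → ℝ := fun z => VectorCalculus.divergence (gradient φ) z with hψ
  have hev : horizonProfile l H 0 =ᶠ[𝓝 x] fun y => (2 : ℝ) • gradient φ y - ψ y • y := by
    filter_upwards [hopen] with y hy
    exact horizonProfile_eq_normalForm hl hH hhom hy
  rw [curl_eq_curlCLM, hev.fderiv_eq, ← curl_eq_curlCLM]
  -- regularity at `x`
  have hC2 : ContDiffAt ℝ 2 φ x := contDiffAt_potential hl hH hx (by norm_cast)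
  have hC3 : ContDiffAt ℝ 3 φ x := contDiffAt_potential hl hH hx (by norm_cast)
  have hg : DifferentiableAt ℝ (gradient φ) x := by
    have hD : DifferentiableAt ℝ (fderiv ℝ φ) x := (hC2.fderiv_right (m := 1) (by norm_num)).differentiableAt (by simp)
    exact ((InnerProductSpace.toDual ℝ E3).symm.differentiableAt).comp x hD
  have hgc : ContDiffAt ℝ 2 (gradient φ) x := by
    have hD : ContDiffAt ℝ 2 (fderiv ℝ φ) x := hC3.fderiv_right (m := 2) (by norm_num)
    exact (InnerProductSpace.toDual ℝ E3).symm.contDiff.contDiffAt.comp x hD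
  have hψd : DifferentiableAt ℝ ψ x := differentiableAt_divergence hgc
  have hψy : DifferentiableAt ℝ (fun y : E3 => ψ y • y) x := hψd.smul differentiableAt_id
  have hg2 : DifferentiableAt ℝ (fun y : E3 => (2 : ℝ) • gradient φ y) x := hg.const_smul (2 : ℝ)
  -- (2) linearity of the curl and the two elementary curls
  have hcurl : curl (fun y => (2 : ℝ) • gradient φ y - ψ y • y) x = -cross (gradient ψ x) x := by
    rw [curl_eq_curlCLM, fderiv_fun_sub hg2 hψy, fderiv_fun_const_smul hg, map_sub, map_smul, ← curl_eq_curlCLM, ← curl_eq_curlCLM,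
      curl_gradient_eq_zero_of_contDiffAt hC2, curl_smul_self hψd, smul_zero, zero_sub]
  rw [hcurl]
  -- (3) `ψ` near `x` in closed form (harmonicity enters here)
  set a : ℝ := ((1 : ℝ) - l) / 2 with ha
  have hψev : ψ =ᶠ[𝓝 x] fun y => (a * (4 * l + 4 * a + 2)) * (H y * (‖y‖ ^ 2) ^ (a - 1)) := by
    filter_upwards [hopen] with y hy
    have hopen' : ∀ᶠ z in 𝓝 y, z ≠ (0 : E3) := isOpen_compl_singleton.mem_nhds hy
    have hgrad : gradient φ =ᶠ[𝓝 y] gradient (fun z : E3 => H z * (‖z‖ ^ 2) ^ a) := by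
      filter_upwards [hopen'] with z hz
      have hloc : φ =ᶠ[𝓝 z] fun w : E3 => H w * (‖w‖ ^ 2) ^ a := by
        filter_upwards [isOpen_compl_singleton.mem_nhds hz] with w hw
        exact potential_eq_rpow hw
      unfold gradient
      rw [hloc.fderiv_eq]
    have h1 : ψ y = VectorCalculus.divergence (gradient (fun z : E3 => H z * (‖z‖ ^ 2) ^ a)) y := by
      simp only [hψ, VectorCalculus.divergence, hgrad.fderiv_eq]
    rw [h1, divergence_gradient_mul_rpow_normSq hy hH hhom hharm a]
    ring
  -- (4) its gradient at `x`
  have hρ : DifferentiableAt ℝ (fun z : E3 => H z * (‖z‖ ^ 2) ^ (a - 1)) x :=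
    (hHd x).mul ((contDiffAt_rpow_normSq hx (a - 1) (n := 1)).differentiableAt (by simp))
  have hgradψ : gradient ψ x = (a * (4 * l + 4 * a + 2) * (‖x‖ ^ 2) ^ (a - 1)) • gradient H x
      + (a * (4 * l + 4 * a + 2) * (2 * ((a - 1) * (‖x‖ ^ 2) ^ (a - 1 - 1)) * H x)) • x := by
    unfold gradient
    rw [hψev.fderiv_eq]
    change gradient (fun y => (a * (4 * l + 4 * a + 2)) * (H y * (‖y‖ ^ 2) ^ (a - 1))) x = _
    rw [gradient_mul_apply (differentiableAt_const _) hρ, gradient_mul_rpow_normSq hx (hHd x) (a - 1)]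
    have h0 : gradient (fun _ : E3 => a * (4 * (l : ℝ) + 4 * a + 2)) x = 0 := by
      unfold gradient
      rw [fderiv_const_apply]  -- fderiv of a constant function
      simp
    rw [h0, smul_zero, add_zero, smul_add, smul_smul, smul_smul]
    rfl
  -- (5) assemble
  rw [hgradψ, cross_smul_add_smul_self, ← neg_smul]
  congr 1
  rw [ha]
  rw [show ((1 : ℝ) - l) / 2 - 1 = -((l : ℝ) + 1) / 2 by ring]
  ring

end Curl

end Summit.NavierStokesRegularity.NavierStokesRegularity.Theorems.PoloidalLiouville.HorizonTower

end
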